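import Literature.MathematicalPhysics.QuantumFieldTheory.Balaban1983to89.Node00.LinearisedAveragingAtBackground
import Literature.MathematicalPhysics.QuantumFieldTheory.Balaban1983to89.Node00.LinearisedAveragingFlat
import Summits.QuantumFields.YangMills.Theorems.BalabanUVNodesN07CritTangentConverse
import Summits.QuantumFields.YangMills.Theorems.BalabanUVNodesN12FlatChartDerivIterLin

/-!
# BalabanUVNodes ∕ N07 — THE KERNEL OF THE LINEARISED AVERAGING `Q_k(U₀)` IS THE FIBRE TANGENT, AND PRINT'S (82) WITH THE NAMED OPERATOR:
# `U` is critical on the fibre `Ū^k = Ū^k(U)` iff `d∕dt A(U·exp(tX))|₀ = 0` for every `X` with `Q_k(U)X = 0` (module D4-kernel of the [15] Sect. B audit of seat `pub-ymgap-dag-n07-w1`)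

Cell `pub-ymgap`, width seat `pub-ymgap-dag-n07-w1` generation 0 (DAG node N07 = [15] = [Balaban1985Variational]; item (α) of dag-n07-e's word l.26171, pointer (iii) KERNEL;
INTENT-5 l.26821).  Key K1⁷ `stmt-QuantumFields-20542`, `--kind proof --supports … --as helper`; count-neutral; THEOREMS ONLY (0 `def`).  CONSUMED BY NAME, nothing modified:
this seat's Literature definer `Node00.LinearisedAveragingAtBackground` (`dIterL` = `Q_k` on matrix fields, `qLin` = the left-trivialised `𝔰𝔲` reading, `qLin_apply`,
`hasDerivAt_coe_iter_expChart_smul`, `qLin_eq_zero_iff_hasDerivAt_zero`), n07-e's 35e `BalabanUVNodesN07CritTangentConverse` (`star_mul_deriv_mem_lieSU`, `smallBelow_of_plaqSmall`,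
`hasDerivAt_coeField_iter`, ★★★ `isCritOfRecord_iff_tangentCritical`) and 35c `BalabanUVNodesN07CritTangentAtRecord` (★★ `exists_fibreCurve_of_kernel_velocity`), 35b
`Node00.AveragingSmooth` (`coeField_iter_eq_iterM`), 35a (`expChart`), n07-w2's `Node00.MultiScaleFibreChart` (`msChart`, `fderiv_msChart_apply_of_hasDerivAt`, `coe_suProj_of_mem`,
`constrEnum`, `AgreeOn` reading), this seat's flat file `Node00.LinearisedAveragingFlat` (`qLin_one_apply`) and dag-n10-w1's
`BalabanUVNodesN12FlatChartDerivIterLin` (`smallBelow_avOfRecord_one`).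

THE PRINT.  [Balaban1985Variational] (82)–(83) p. 290: *«δA(U₀)·X = 0 for all X satisfying Q_k(U₀)X = 0»* (the tangent form of criticality on the fibre of the `k`-fold
averaging), (44)–(45) p. 285 (`Q_k(U₀)`), (3)–(5) p. 278 (the variational problem); [Balaban1987RG1] (0.4) p. 253, (0.21) p. 256.

CONTENTS.  §1 on any torus `P`, under 35b's guard `SmallBelow … k U₀`: ★ `qLin_mem_lieSU` — `(Q_k(U₀)X)(c) ∈ 𝔰𝔲(N)` (35e's closed-subgroup velocity lemma on the `SU(N)`-valued
curve `t ↦ Ū^k(U₀·exp(tX))(c)`, whose matrix velocity is the definer file's `dIterL k ↑U₀ [b ↦ U₀,b X_b] c`).  §2 under 35c∕35e's small-field letters (`t₀`-small iterated averages,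
`stokesConst·t₀ < δ_N`, `< |I|⁻¹∕16`, `k ≤ m + K`): `dIterL_apply_eq_zero_of_fibreCurve` (KERNEL ⊇ FIBRE TANGENT in operator currency: the matrix velocity `Y` of any fibre curve is
killed by `Q_k`), `qLin_eq_zero_of_fibreCurve`, `exists_fibreCurve_of_qLin_eq_zero` (KERNEL ⊆ FIBRE TANGENT at the one-scale pin, 35c's corrector curve), ★★★
`qLin_eq_zero_iff_exists_fibreCurve` — **`Q_k(U)X = 0` IFF `U·X` IS THE VELOCITY OF A CURVE INSIDE THE FIBRE `Ū^k = Ū^k(U)`**.  §3 at NODE 00's objects: ★★★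
`isCritOfRecord_iff_hasDerivAt_zero_on_ker_qLin` — **the tree's curve-form pin `IsCritOfRecord` ⟺ print's (82) with the NAMED operator: `∀ X, qLin k U X = 0 → d∕dt A(U·exp(tX))|₀ = 0`**;
and for n07-w2's MULTI-SCALE chart `msChart` (several levels at once, any determining set `𝔹`): ★★ `coe_fderiv_msChart_apply_eq_qLin` (`(DΦ(0)X)_{(j,c)} = (qLin j U X)(c)`), ★★★
`fderiv_msChart_apply_eq_zero_iff` — **`DΦ(0)X = 0 ⟺ (qLin j U X)(c) = 0` at every constrained bond `(j,c)` of `𝔹`** (the multi-scale kernel is the joint kernel of the `Q_j(U)`);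
at the FLAT background: ★ `dIterL_one_coe_mem_lieSU` ∕ ★★ `dIterL_one_coe_mem_lieSU_avOfRecord` — `(Q_k(1)↑X)(c) ∈ 𝔰𝔲(N)` (hypothesis-free at NODE 00's objects).

HONEST FRAMING: rephrasings of 35c∕35e's and n07-w2's theorems in the currency of the named operator, plus the `𝔰𝔲(N)`-membership; the fibre-tangent equivalence is at the
one-scale pin (as in 35c∕35e), the multi-scale statement is about the chart's DERIVATIVE only (surjectivity ∕ right inverse (45) stay displayed hypotheses of n07-w2's files); nothing of [15]'s estimates; N07 NOT discharged; counts unmoved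
(5∕27); one finite 𝕋⁴ programme at fixed ε — R4 closes the conditional rung `BalabanLadder.UV` only; the YM mass gap (Clay) is NOT proved by any of this.  No `sorry`, no `def`.
-/

noncomputable section

namespace Summit.QuantumFields.YangMills.BalabanUVNodes.N07LinearisedAveragingKernel

open scoped Matrix.Norms.L2Operator Topology
open Filter
open Literature.MathematicalPhysics.QuantumFieldTheory.Balaban1983to89
open Literature.MathematicalPhysics.QuantumFieldTheory.Balaban1983to89.T4Continuum (T4Family)
open Literature.MathematicalPhysics.QuantumFieldTheory.Balaban1983to89.B15DeterminingSets
open Literature.MathematicalPhysics.QuantumFieldTheory.Balaban1983to89.BlockAveraging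
open Literature.MathematicalPhysics.QuantumFieldTheory.Balaban1983to89.BlockAveragingEMLHaarAC (emlWeight)
open Literature.MathematicalPhysics.QuantumFieldTheory.Balaban1983to89.ExpMeanLog (expMeanLogSU deltaSU)
open Literature.MathematicalPhysics.QuantumFieldTheory.Balaban1983to89.T4AdjointCovarianceUnitary (lieSU)
open Literature.MathematicalPhysics.QuantumFieldTheory.Balaban1983to89.Node00
open Summit.QuantumFields.YangMills.Theorems.BlockAvgCorrector (stokesConst)
open Summit.QuantumFields.YangMills.BalabanUVNodes.N07CritTangentConverse (star_mul_deriv_mem_lieSU smallBelow_of_plaqSmall hasDerivAt_coeField_iter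
  isCritOfRecord_iff_tangentCritical)
open Summit.QuantumFields.YangMills.BalabanUVNodes.N07CritTangentAtRecord (exists_fibreCurve_of_kernel_velocity)

section Torus

variable {P : Params} {N : ℕ} [NeZero N]

/-- ★ **`(Q_k(U₀)X)(c) ∈ 𝔰𝔲(N)`** under the guard below `k`: the left-trivialised velocity of the `SU(N)`-valued curve `t ↦ Ū^k(U₀·exp(tX))(c)` (35e
`star_mul_deriv_mem_lieSU` on the definer file's `hasDerivAt_coe_iter_expChart_smul`; `iterM k ↑U₀ = ↑Ū^k(U₀)` on the guard). [cite: Balaban1985Variational, (4) p.278, (44) p.285] -/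
theorem qLin_mem_lieSU {U₀ : GaugeField P 0 (SU N)} {k : ℕ} (h : SmallBelow (fun j => blockAvg (P := P) (j := j) expMeanLogSU) k U₀)
    (X : PBond P 0 → lieSU (Fin N)) (c : PBond P k) : qLin k U₀ X c ∈ lieSU (Fin N) := by
  have hγ := hasDerivAt_coe_iter_expChart_smul h X c
  have hmem := star_mul_deriv_mem_lieSU hγ
  rw [zero_smul, expChart_zero] at hmem
  rw [qLin_apply, ← coeField_iter_eq_iterM k h, coeField_apply]
  exact hmem

/-- **KERNEL ⊇ FIBRE TANGENT, operator currency**: along a family `Γ` with matrix velocity `Y` at `0`, `t₀`-small iterated averages at `Γ 0`, and `Ū^k(Γ t) = Ū^k(Γ 0)` near `0`,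
`Q_k(↑Γ 0) Y = 0` (35e `hasDerivAt_coeField_iter` against the derivative of an eventually constant function). [cite: Balaban1985Variational, (44)-(45) p.285, (83) p.290; Balaban1987RG1, (0.21) p.256] -/
theorem dIterL_apply_eq_zero_of_fibreCurve {t₀ : ℝ} (ht₀ : 0 < t₀) (hstδ : stokesConst P * t₀ < deltaSU (Fin N))
    {Γ : ℝ → GaugeField P 0 (SU N)} {Y : PBond P 0 → Matrix (Fin N) (Fin N) ℂ} (hΓ : HasDerivAt (fun t => coeField (Γ t)) Y 0) {k : ℕ}
    (hsm : ∀ i, i < k → PlaqSmall t₀ (Averaging.iter (fun i => blockAvg (P := P) (j := i) (expMeanLogSU (n := Fin N))) i (Γ 0)))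
    (hfib : ∀ᶠ t in 𝓝 (0 : ℝ), Averaging.iter (fun i => blockAvg (P := P) (j := i) (expMeanLogSU (n := Fin N))) k (Γ t) =
      Averaging.iter (fun i => blockAvg (P := P) (j := i) (expMeanLogSU (n := Fin N))) k (Γ 0)) :
    dIterL k (coeField (Γ 0)) Y = 0 := by
  have hD := hasDerivAt_coeField_iter ht₀ hstδ hΓ (k := k) hsm
  have hC : HasDerivAt (fun t => coeField (Averaging.iter (fun i => blockAvg (P := P) (j := i) (expMeanLogSU (n := Fin N))) k (Γ t)))
      (0 : PBond P k → Matrix (Fin N) (Fin N) ℂ) 0 :=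
    (hasDerivAt_const (0 : ℝ) (coeField (Averaging.iter (fun i => blockAvg (P := P) (j := i) (expMeanLogSU (n := Fin N))) k (Γ 0)))).congr_of_eventuallyEq
      (hfib.mono fun t ht => by simp only [ht])
  exact hD.unique hC

/-- **KERNEL ⊇ FIBRE TANGENT**: if `U·X` is the bond-wise velocity of a curve inside the fibre `Ū^k = Ū^k(U)` through `U`, then `Q_k(U)X = 0`. [cite: Balaban1985Variational, (44)-(45) p.285, (83) p.290] -/
theorem qLin_eq_zero_of_fibreCurve {t₀ : ℝ} (ht₀ : 0 < t₀) (hstδ : stokesConst P * t₀ < deltaSU (Fin N)) {k : ℕ} {U : GaugeField P 0 (SU N)}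
    (hsm : ∀ i, i < k → PlaqSmall t₀ (Averaging.iter (fun i => blockAvg (P := P) (j := i) (expMeanLogSU (n := Fin N))) i U))
    {X : PBond P 0 → lieSU (Fin N)} {γ : ℝ → GaugeField P 0 (SU N)} (hγ0 : γ 0 = U)
    (hvel : ∀ b : PBond P 0, HasDerivAt (fun t => ((γ t b : SU N) : Matrix (Fin N) (Fin N) ℂ)) ((U b : Matrix (Fin N) (Fin N) ℂ) * (X b : Matrix (Fin N) (Fin N) ℂ)) 0)
    (hfib : ∀ᶠ t in 𝓝 (0 : ℝ), Averaging.iter (fun i => blockAvg (P := P) (j := i) (expMeanLogSU (n := Fin N))) k (γ t) =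
      Averaging.iter (fun i => blockAvg (P := P) (j := i) (expMeanLogSU (n := Fin N))) k U) :
    qLin k U X = 0 := by
  subst hγ0
  have hΓ : HasDerivAt (fun t => coeField (γ t)) (fun b => ((γ 0 b : SU N) : Matrix (Fin N) (Fin N) ℂ) * (X b : Matrix (Fin N) (Fin N) ℂ)) 0 :=
    hasDerivAt_pi.2 hvel
  have h0 := dIterL_apply_eq_zero_of_fibreCurve ht₀ hstδ hΓ hsm hfib
  funext c
  rw [qLin_apply, h0]
  simp

/-- **KERNEL ⊆ FIBRE TANGENT at the one-scale pin** (`k ≤ m + K`, `stokesConst·t₀ < |I|⁻¹∕16`): every `X` with `Q_k(U)X = 0` is the left-trivialised velocity of a curve inside the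
fibre (35c's corrector curve `exists_fibreCurve_of_kernel_velocity`). [cite: Balaban1985Variational, (44)-(45) p.285, (83) p.290, Prop. 8 p.304] -/
theorem exists_fibreCurve_of_qLin_eq_zero {t₀ : ℝ} (ht₀ : 0 < t₀) (hst : stokesConst P * t₀ < emlWeight P / 16)
    (hstδ : stokesConst P * t₀ < deltaSU (Fin N)) {k : ℕ} (hk : k ≤ P.m + P.K) {U : GaugeField P 0 (SU N)}
    (hsm : ∀ i, i < k → PlaqSmall t₀ (Averaging.iter (fun i => blockAvg (P := P) (j := i) (expMeanLogSU (n := Fin N))) i U))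
    {X : PBond P 0 → lieSU (Fin N)} (hX : qLin k U X = 0) :
    ∃ γ : ℝ → GaugeField P 0 (SU N), γ 0 = U ∧
      (∀ b : PBond P 0, HasDerivAt (fun t => ((γ t b : SU N) : Matrix (Fin N) (Fin N) ℂ))
        ((U b : Matrix (Fin N) (Fin N) ℂ) * (X b : Matrix (Fin N) (Fin N) ℂ)) 0) ∧
      ∀ᶠ t in 𝓝 (0 : ℝ), Averaging.iter (fun i => blockAvg (P := P) (j := i) (expMeanLogSU (n := Fin N))) k (γ t) =
        Averaging.iter (fun i => blockAvg (P := P) (j := i) (expMeanLogSU (n := Fin N))) k U :=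
  exists_fibreCurve_of_kernel_velocity ht₀ hst hstδ hk hsm
    ((qLin_eq_zero_iff_hasDerivAt_zero (smallBelow_of_plaqSmall ht₀ hstδ hsm) X).1 hX)

/-- ★★★ **KERNEL = FIBRE TANGENT.**  At the one-scale pin, for `U` with `t₀`-small iterated averages: `Q_k(U)X = 0` IFF there is a curve `γ`, `γ 0 = U`, with bond-wise velocity
`U_b·X_b`, staying in the fibre `Ū^k(γ t) = Ū^k(U)` near `0`. [cite: Balaban1985Variational, (44)-(45) p.285, (82)-(83) p.290] -/
theorem qLin_eq_zero_iff_exists_fibreCurve {t₀ : ℝ} (ht₀ : 0 < t₀) (hst : stokesConst P * t₀ < emlWeight P / 16)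
    (hstδ : stokesConst P * t₀ < deltaSU (Fin N)) {k : ℕ} (hk : k ≤ P.m + P.K) {U : GaugeField P 0 (SU N)}
    (hsm : ∀ i, i < k → PlaqSmall t₀ (Averaging.iter (fun i => blockAvg (P := P) (j := i) (expMeanLogSU (n := Fin N))) i U))
    (X : PBond P 0 → lieSU (Fin N)) :
    qLin k U X = 0 ↔ ∃ γ : ℝ → GaugeField P 0 (SU N), γ 0 = U ∧
      (∀ b : PBond P 0, HasDerivAt (fun t => ((γ t b : SU N) : Matrix (Fin N) (Fin N) ℂ))
        ((U b : Matrix (Fin N) (Fin N) ℂ) * (X b : Matrix (Fin N) (Fin N) ℂ)) 0) ∧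
      ∀ᶠ t in 𝓝 (0 : ℝ), Averaging.iter (fun i => blockAvg (P := P) (j := i) (expMeanLogSU (n := Fin N))) k (γ t) =
        Averaging.iter (fun i => blockAvg (P := P) (j := i) (expMeanLogSU (n := Fin N))) k U :=
  ⟨exists_fibreCurve_of_qLin_eq_zero ht₀ hst hstδ hk hsm, fun ⟨_, hγ0, hvel, hfib⟩ => qLin_eq_zero_of_fibreCurve ht₀ hstδ hsm hγ0 hvel hfib⟩

/-- ★ **AT THE FLAT BACKGROUND `Q_k(1)` MAPS LIE-ALGEBRA FIELDS INTO `𝔰𝔲(N)`** (torus form, the flat guard displayed): `(dIterL k 1 ↑X)(c) ∈ 𝔰𝔲(N)` — §1 at `U₀ = 1` through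
the flat file's `qLin_one_apply`. [cite: Balaban1985Variational, (44),(47) p.285; Balaban1985Averaging, (124)-(125) p.36] -/
theorem dIterL_one_coe_mem_lieSU {k : ℕ} (h1 : SmallBelow (fun j => blockAvg (P := P) (j := j) expMeanLogSU) k (1 : GaugeField P 0 (SU N)))
    (X : PBond P 0 → lieSU (Fin N)) (c : PBond P k) :
    dIterL k (1 : PBond P 0 → Matrix (Fin N) (Fin N) ℂ) (fun b => (X b : Matrix (Fin N) (Fin N) ℂ)) c ∈ lieSU (Fin N) := by
  rw [← qLin_one_apply]
  exact qLin_mem_lieSU h1 X c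

end Torus

section Record

variable {F : T4Family} {N : ℕ} [NeZero N]

/-- ★★★ **PRINT'S (82) WITH THE NAMED OPERATOR.**  At NODE 00's objects, at a level `k ≤ m + K`, for `U` with `t₀`-small iterated averages (`stokesConst·t₀ < |I|⁻¹∕16`,
`< δ_N`): `U` is critical on `𝔅_k(Ū^k(U))` in the tree's CURVE form `IsCritOfRecord` IFF `d∕dt A(U·exp(tX))|₀ = 0` for every Lie-algebra field `X` with `Q_k(U)X = 0`
(35e `isCritOfRecord_iff_tangentCritical` + the definer file's `qLin_eq_zero_iff_hasDerivAt_zero`). [cite: Balaban1985Variational, (3),(5) p.278, (44) p.285, (82)-(83) p.290, (141) p.299] -/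
theorem isCritOfRecord_iff_hasDerivAt_zero_on_ker_qLin {K k : ℕ} (hk : k ≤ (F.P K).m + (F.P K).K) {t₀ : ℝ} (ht₀ : 0 < t₀)
    (hst : stokesConst (F.P K) * t₀ < emlWeight (F.P K) / 16) (hstδ : stokesConst (F.P K) * t₀ < deltaSU (Fin N))
    {U : GaugeField (F.P K) 0 (SU N)} (hsm : ∀ i, i < k → PlaqSmall t₀ (avgFamily (avOfRecord F N K) U i)) :
    IsCritOfRecord F N K k (avgFamily (avOfRecord F N K) U k) U ↔
      ∀ X : PBond (F.P K) 0 → lieSU (Fin N), qLin k U X = 0 → HasDerivAt (fun t : ℝ => wilsonAction4 (expChart U (t • X))) 0 0 := by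
  rw [isCritOfRecord_iff_tangentCritical hk ht₀ hst hstδ hsm]
  have hsb : SmallBelow (avOfRecord F N K) k U := smallBelow_of_plaqSmall ht₀ hstδ hsm
  refine forall_congr' fun X => ?_
  rw [qLin_eq_zero_iff_hasDerivAt_zero hsb X]
  rfl

/-- ★★ **THE DERIVATIVE OF n07-w2's MULTI-SCALE CHART IS `Q_j(U)` ON THE CONSTRAINED BONDS.**  On the fibre (`AgreeOn 𝔹 (Ū^•(U)) W`) and under the guard below `k`, for every
constrained bond `i ↔ (j, c)` of `𝔹` with `j ≤ k`: `(DΦ(0)X)_i = (qLin j U X)(c)` as matrices (`Φ = msChart F N K k 𝔹 W U`; n07-w2's `fderiv_msChart_apply_of_hasDerivAt` at the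
definer file's velocity, `suProj` being the identity on `𝔰𝔲(N)` by §1). [cite: Balaban1985Variational, Sect. C (47)-(48) p.285, (82)-(83) p.290; Balaban1988Convergent, (2.10)-(2.12) p.256] -/
theorem coe_fderiv_msChart_apply_eq_qLin {K k : ℕ} {𝔹 : DetSet (F.P K)} {W : MSField (F.P K) (SU N)} {U : GaugeField (F.P K) 0 (SU N)}
    (hU : AgreeOn 𝔹 (avgFamily (avOfRecord F N K) U) W) (hsb : SmallBelow (avOfRecord F N K) k U)
    (X : PBond (F.P K) 0 → lieSU (Fin N)) (i : Fin (constrCard 𝔹 k)) :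
    ((fderiv ℝ (msChart F N K k 𝔹 W U) 0 X i : lieSU (Fin N)) : Matrix (Fin N) (Fin N) ℂ) =
      qLin (((constrEnum 𝔹 k).symm i).1 : ℕ) U X ((constrEnum 𝔹 k).symm i).2.1 := by
  set j : Fin (k + 1) := ((constrEnum 𝔹 k).symm i).1 with hj
  set c : PBond (F.P K) j := ((constrEnum 𝔹 k).symm i).2.1 with hc
  have hcmem : c ∈ bondsOf (𝔹 j) := ((constrEnum 𝔹 k).symm i).2.2
  have hsbj : SmallBelow (avOfRecord F N K) j U := hsb.mono (Nat.le_of_lt_succ j.isLt)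
  have hv := hasDerivAt_coe_iter_expChart_smul (P := F.P K) hsbj X c
  rw [fderiv_msChart_apply_of_hasDerivAt hU hsb X i hv, coe_suProj_of_mem]
  · rw [qLin_apply, ← hU j c hcmem, ← coeField_iter_eq_iterM (j : ℕ) hsbj, coeField_apply]
    rfl
  · rw [← hU j c hcmem]
    have hm := qLin_mem_lieSU (P := F.P K) hsbj X c
    rw [qLin_apply, ← coeField_iter_eq_iterM (j : ℕ) hsbj, coeField_apply] at hm
    exact hm

/-- ★★★ **THE MULTI-SCALE KERNEL.**  On the fibre and under the guard below `k`: `DΦ(0)X = 0` IFF `(Q_j(U)X)(c) = 0` at EVERY constrained bond `(j, c)` of `𝔹`, `j ≤ k` — the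
kernel of the linearised multi-scale constraint of V16 stub 1 is the joint kernel of the named operators `qLin j U` on `𝔹`. [cite: Balaban1985Variational, (44)-(45) p.285, (82)-(83) p.290; Balaban1988Convergent, (2.10)-(2.12) p.256] -/
theorem fderiv_msChart_apply_eq_zero_iff {K k : ℕ} {𝔹 : DetSet (F.P K)} {W : MSField (F.P K) (SU N)} {U : GaugeField (F.P K) 0 (SU N)}
    (hU : AgreeOn 𝔹 (avgFamily (avOfRecord F N K) U) W) (hsb : SmallBelow (avOfRecord F N K) k U)
    (X : PBond (F.P K) 0 → lieSU (Fin N)) :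
    fderiv ℝ (msChart F N K k 𝔹 W U) 0 X = 0 ↔
      ∀ i : Fin (constrCard 𝔹 k), qLin (((constrEnum 𝔹 k).symm i).1 : ℕ) U X ((constrEnum 𝔹 k).symm i).2.1 = 0 := by
  constructor
  · intro h i
    rw [← coe_fderiv_msChart_apply_eq_qLin hU hsb X i, h]
    rfl
  · intro h
    funext i
    apply Subtype.ext
    rw [coe_fderiv_msChart_apply_eq_qLin hU hsb X i, h i]
    rfl

/-- ★★ **AT NODE 00's OBJECTS, HYPOTHESIS-FREE: `(Q_k(1)↑X)(c) ∈ 𝔰𝔲(N)`** for every Lie-algebra field `X` and every level `k` (the flat configuration is on the guard at every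
level — dag-n10-w1's `N12FlatChartDerivIterLin.smallBelow_avOfRecord_one`, BY NAME). [cite: Balaban1985Variational, (44),(47) p.285; Balaban1987RG1, (0.4) p.253] -/
theorem dIterL_one_coe_mem_lieSU_avOfRecord {K k : ℕ} (X : PBond (F.P K) 0 → lieSU (Fin N)) (c : PBond (F.P K) k) :
    dIterL k (1 : PBond (F.P K) 0 → Matrix (Fin N) (Fin N) ℂ) (fun b => (X b : Matrix (Fin N) (Fin N) ℂ)) c ∈ lieSU (Fin N) :=
  dIterL_one_coe_mem_lieSU (P := F.P K) (N12FlatChartDerivIterLin.smallBelow_avOfRecord_one (F := F) (N := N) (K := K) (k := k)) X c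

end Record

end Summit.QuantumFields.YangMills.BalabanUVNodes.N07LinearisedAveragingKernel

end
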